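import Literature.MathematicalPhysics.QuantumFieldTheory.Balaban1983to89.B8SockB9P3H2AtPeriodizedTower
import Literature.MathematicalPhysics.QuantumFieldTheory.Balaban1983to89.B8IdxB8SubDPeriodize
import Literature.MathematicalPhysics.QuantumFieldTheory.Balaban1983to89.B8SockB9P3H2AtTopCubeTowerMember

/-!
# `Balaban1983to89.B8SockB9P3H2AtPeriodizedTowerMember` — [Balaban1985RegularSpaces] (1.59) p. 86, (1.5) p. 77, (1.131) p. 99, p. 77 («Ω_j = T_η»): the per-shape
# socket of `B8SockB9P3H2AtPeriodizedTower` READ AT THE INDEX MEMBERS — every law member `i : ZdIdx` with `i.Ω = periodize (fun _ ↦ P) (cubeFam true θ.L a M ρ k)`,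
# `i.k = k` (its families are print's `Lam` by dag-n05-w2's RIGIDITY), hence every member of the (1.5)-obeying index `IdxB8SubD θ` and of the PERIODIC CUT
# `IdxB8SubDPer θ P` over the periodised Sect.-F tower; non-vacuity at dag-n05-w2's carried member; one triple of constants for all depths `k ≤ K`

statement-level skeleton of published theorems with citation tags; proofs where landed; nothing here is a claim about the
Yang–Mills mass gap

`[Balaban1985RegularSpaces]` ("B8", CMP **99** (1985) 75–102) (1.59) p. 86, (1.5)–(1.6) p. 77, (1.68) p. 88, (1.131) p. 99, (1.31) p. 82, p. 77 («we admit the case when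
some domains Ω_j are equal to T_η»); [4] = `[Balaban1985BackgroundPropagators]` Thm 3.3 p. 399; [B6] = `[Balaban1984PropagatorsII]` (2.1)–(2.3) p. 224; [B11] =
`[Balaban1985Variational]` (3) p. 278 (the level sets `B11Eq7Convention.Lam`).

CITATION HEADER (lean-in-tree rule).  Cell `pub-ymgap` (YM Track A, HUMAN RULING D-0062 ∕ D-0149), node N05 = [B8], width seat `pub-ymgap-dag-n05-w3` (g5), CLAIM-1
file (C).  WHY.  The socket binders of the N05 row (`SB9P : ∀ i, … → SockB9P3H2 θ.L B₀ B₀β cB9 β len i.η i.k i.Ω i.Λs (fun m j => towerBondsP θ.L i.Ω (i.Λs m) j)`)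
read an index member's OWN restriction families `i.Λs`; file (B) is stated for families that ARE print's level sets `Lam L Ωᴾ k` up to the depth.  dag-n05-w2's
RIGIDITY (`B8IdxB8SubDRigidity.Λs_eq_lam_of_lamTop` ∕ `IdxB8SubD.Λs_eq_lam`: at a member obeying the located laws, (1.3)–(1.4) and (1.5), the families ARE [B11]'s
level sets of its domains) closes the gap by name; dag-n05-w2's `B8IdxB8SubDPeriodize` CARRIES the periodised Sect.-F tower as a member of `IdxB8SubD θ` and of the
periodic cut `IdxB8SubDPer θ P` (director-ym №217: the (β′-PERIODIC) road of record), so the binder's body is inhabited at a NESTED periodic member.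

THE MATHEMATICS (kernel-checked).  §1 ★★★ `sockB9P3H2_periodize_lawMember` (`∀ a P`, `θ.Lᵏ ∣ P`, `θ.Lᵏ·M + 2·ρ·gs θ.L k ≤ P`, `∀ i : ZdIdx θ.D θ.L` with `i.Ω = Ωᴾ`,
`i.k = k`, `IdxB8Laws`, `DomainSeq`, (1.5) ⊢ `SockB9P3H2 … i.η i.k i.Ω i.Λs (towerBondsP)`), ★★★ `sockB9P3H2_periodize_idxB8SubD`, ★★★ `sockB9P3H2_periodize_idxB8SubDPer`
(the same at the members of the (1.5)-index ∕ of the periodic cut over `Ωᴾ`), ★ `exists_idxB8SubDPer_sockB9P3H2_periodize` (NON-VACUITY: dag-n05-w2's carried member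
of the periodic cut, with the socket holding there); §2 `sockB9P3H2_periodize_lawMember_depth` (one triple of constants for all depths `1 ≤ k ≤ K` — a finite maximum,
constants depending on `K`).

HONEST SCOPE ∕ A6.  The constants depend on the SHAPE `(L, M, ρ, k)` (resp. on `K`), `β`, `d`, `θ.𝔸`, `len` — NOT on `P`, `a`, `η`; this is the positive A6 datum for
the `SB9P`-shape body at NESTED `P`-periodic (1.5)-members — NOT the class-wide binder (ONE `B₀(d, L)` over all admissible towers = [4] Thm 3.3 = N06), and it inhabits
no knit hypothesis as typed; no letter of [4] assumed or proved; nothing of dag-n05-w2's ∕ dag-n05-w1's files restated (their members and cut consumed BY NAME).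
Count-neutral; N05 NOT discharged; no count claim; one finite `𝕋⁴` programme at fixed `ε`, Bałaban as printed; the YM mass gap (Clay) is NOT proved by any of this —
R4 closes the conditional finite-`𝕋⁴` rung `BalabanLadder.UV` only; nothing continuum ∕ ℝ⁴ ∕ OS.  No `sorry`, no `def`, no `instance`, no `notation`.
Unit `pub-ymgap-dag-n05-w3` (g5), 2026-08-28.
-/

noncomputable section

namespace Literature.MathematicalPhysics.QuantumFieldTheory.Balaban1983to89.B8SockB9P3H2AtPeriodizedTowerMember

open B7Prop1Explicit B7Prop1Local
open B7Prop4GeneralLevels (linCovIter)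
open B8Eq146AExpansion (iEta)
open B8Eq155JBound (Jcur wsup)
open B8ScaledSupNorm (bondNorm)
open B8LeafModelZd (ZdIdx)
open B8ConstraintBonds (DomainSeq Lam)
open B8Eq131Cubes (gs)
open B8Eq131CubesAdmissible (cubeFam)
open B8TowerBondsPrinted (towerBondsP)
open B9SupplySockB9P3ZdGammaUnivDelta2 (SockB9P3H2)
open B8IdxB8SubDRigidity (Λs_eq_lam_of_lamTop)
open B8SockB9P3H2AtTopCubeTowerMember (sockB9P3H2_mono)
open B8SockB9P3H2AtPeriodizedTower (exists_sockB9P3H2_periodize)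
open B8IdxB8SubDPeriodize (exists_idxB8SubDPer_periodize_cubeFam)
open B15LatticeCubeTorus (periodize)
open Node00 (Stage3Params IdxB8Laws IdxB8SubD IdxB8SubDPer)

-- `Site` alone would resolve to the torus sites of `Setup.lean`; re-export the `ℤ^d` sites of `B7Prop1Explicit`.
export B7Prop1Explicit (Site)

/-! ## §1 The socket at the index members over the periodised tower -/

/-- ★★★ **THE `SB9P` BINDER'S BODY AT EVERY LAW MEMBER OVER A PERIODISED SECT.-F TOWER OF ONE SHAPE.**  For a record `θ` with `θ.D ≥ 2` and finite-dimensional `θ.𝔸`,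
a shape `(M, ρ ≥ L, k ≥ 1)`, `β ≥ 0` and a length function with `len z ≥ 1` (`z ≠ 0`): ONE triple `B₀, B₀β, cP > 0` such that for every centre `a`, every period `P` with
`θ.Lᵏ ∣ P` and `θ.Lᵏ·M + 2·ρ·gs θ.L k ≤ P`, and every index member `i : ZdIdx θ.D θ.L` with `i.Ω = periodize (fun _ ↦ P) (cubeFam true θ.L a M ρ k)`, `i.k = k`, obeying
the located laws `IdxB8Laws`, (1.3)–(1.4) `DomainSeq` and print's (1.5), the socket `SockB9P3H2 θ.L B₀ B₀β cP β len i.η i.k i.Ω i.Λs (fun m j => towerBondsP θ.L i.Ω (i.Λs m) j)`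
HOLDS (any spacing `i.η`).  Rigidity (`Λs_eq_lam_of_lamTop`) + file (B).  Shape-dependent constants: NOT [4] Thm 3.3.
[cite: Balaban1985RegularSpaces, (1.59) p.86, (1.5) p.77, (1.131) p.99, (1.31) p.82, p.77 («Ω_j = T_η»); Balaban1985BackgroundPropagators, Thm 3.3 p.399; Balaban1984PropagatorsII, (2.1)–(2.3) p.224; Balaban1985Variational, (3) p.278] -/
theorem sockB9P3H2_periodize_lawMember (θ : Stage3Params) [FiniteDimensional ℂ θ.𝔸] (hD : 2 ≤ θ.D) (M : ℕ) {ρ : ℕ} (hρ : θ.L ≤ ρ)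
    {k : ℕ} (hk : 1 ≤ k) {β : ℝ} (hβ : 0 ≤ β) {len : Site θ.D → ℝ} (hlen : ∀ z : Site θ.D, z ≠ 0 → 1 ≤ len z) :
    ∃ B₀ B₀β cP : ℝ, 0 < B₀ ∧ 0 < B₀β ∧ 0 < cP ∧ ∀ (a : Site θ.D) (P : ℕ), θ.L ^ k ∣ P → θ.L ^ k * M + 2 * (ρ * gs θ.L k) ≤ P →
      ∀ i : ZdIdx θ.D θ.L, i.Ω = periodize (fun _ : Fin θ.D => P) (cubeFam true θ.L a M ρ k) → i.k = k →
      IdxB8Laws θ.L i → DomainSeq θ.L i.Ω → (∀ l, l < i.k → ∀ z ∈ i.Λs i.k l, ((θ.L : ℤ) ^ l) • z ∈ Lam θ.L i.Ω l) →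
        SockB9P3H2 (𝔸 := θ.𝔸) θ.L B₀ B₀β cP β len i.η i.k i.Ω i.Λs (fun m j => towerBondsP θ.L i.Ω (i.Λs m) j) := by
  have hL : 1 ≤ θ.L := le_trans (by norm_num) θ.two_le_L
  obtain ⟨B₀, B₀β, cP, hB₀, hB₀β, hcP, H⟩ := exists_sockB9P3H2_periodize (𝔹 := θ.𝔸) hD θ.two_le_L M hρ hk hβ hlen
  refine ⟨B₀, B₀β, cP, hB₀, hB₀β, hcP, fun a P hdvd hP i hΩ hkk hlaws hdom h15 => ?_⟩
  have hΛ : ∀ l, l ≤ k → i.Λs k l = B11Eq7Convention.Lam θ.L (periodize (fun _ : Fin θ.D => P) (cubeFam true θ.L a M ρ k)) k l := fun l hl => by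
    have h := Λs_eq_lam_of_lamTop hL i hlaws hdom h15 (m := i.k) le_rfl (l := l) (by rw [hkk]; exact hl)
    rwa [hkk, hΩ] at h
  rw [hkk, hΩ]
  exact H a i.η i.hη P hdvd hP i.Λs hΛ

/-- ★★★ **THE SAME AT EVERY MEMBER OF THE (1.5)-OBEYING INDEX OF RECORD `IdxB8SubD θ` OVER A PERIODISED SECT.-F TOWER OF ONE SHAPE** (laws, (1.3)–(1.4), (1.5) are the
index's fields). [cite: Balaban1985RegularSpaces, (1.59) p.86, (1.5) p.77, (1.131) p.99, p.77 («Ω_j = T_η»); Balaban1985BackgroundPropagators, Thm 3.3 p.399] -/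
theorem sockB9P3H2_periodize_idxB8SubD (θ : Stage3Params) [FiniteDimensional ℂ θ.𝔸] (hD : 2 ≤ θ.D) (M : ℕ) {ρ : ℕ} (hρ : θ.L ≤ ρ)
    {k : ℕ} (hk : 1 ≤ k) {β : ℝ} (hβ : 0 ≤ β) {len : Site θ.D → ℝ} (hlen : ∀ z : Site θ.D, z ≠ 0 → 1 ≤ len z) :
    ∃ B₀ B₀β cP : ℝ, 0 < B₀ ∧ 0 < B₀β ∧ 0 < cP ∧ ∀ (a : Site θ.D) (P : ℕ), θ.L ^ k ∣ P → θ.L ^ k * M + 2 * (ρ * gs θ.L k) ≤ P →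
      ∀ j : IdxB8SubD θ, j.1.1.1.1.Ω = periodize (fun _ : Fin θ.D => P) (cubeFam true θ.L a M ρ k) → j.1.1.1.1.k = k →
        SockB9P3H2 (𝔸 := θ.𝔸) θ.L B₀ B₀β cP β len j.1.1.1.1.η j.1.1.1.1.k j.1.1.1.1.Ω j.1.1.1.1.Λs
          (fun m l => towerBondsP θ.L j.1.1.1.1.Ω (j.1.1.1.1.Λs m) l) := by
  obtain ⟨B₀, B₀β, cP, hB₀, hB₀β, hcP, H⟩ := sockB9P3H2_periodize_lawMember θ hD M hρ hk hβ hlen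
  exact ⟨B₀, B₀β, cP, hB₀, hB₀β, hcP, fun a P hdvd hP j hΩ hkk => H a P hdvd hP j.1.1.1.1 hΩ hkk j.1.1.2.toIdxB8Laws j.1.2 j.2⟩

/-- ★★★ **THE SAME AT EVERY MEMBER OF THE PERIODIC CUT `IdxB8SubDPer θ P` OVER A PERIODISED SECT.-F TOWER OF ONE SHAPE** (dag-n05-w1's (P2) index of the (β′-PERIODIC)
road; its members are `IdxB8SubD` members with `P`-periodic domains). [cite: Balaban1985RegularSpaces, (1.59) p.86, (1.5) p.77, (1.131) p.99, p.77 («Ω_j = T_η»); Balaban1985BackgroundPropagators, Thm 3.3 p.399] -/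
theorem sockB9P3H2_periodize_idxB8SubDPer (θ : Stage3Params) [FiniteDimensional ℂ θ.𝔸] (hD : 2 ≤ θ.D) (M : ℕ) {ρ : ℕ} (hρ : θ.L ≤ ρ)
    {k : ℕ} (hk : 1 ≤ k) {β : ℝ} (hβ : 0 ≤ β) {len : Site θ.D → ℝ} (hlen : ∀ z : Site θ.D, z ≠ 0 → 1 ≤ len z) :
    ∃ B₀ B₀β cP : ℝ, 0 < B₀ ∧ 0 < B₀β ∧ 0 < cP ∧ ∀ (a : Site θ.D) (P : ℕ), θ.L ^ k ∣ P → θ.L ^ k * M + 2 * (ρ * gs θ.L k) ≤ P →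
      ∀ j : IdxB8SubDPer θ P, j.1.1.1.1.1.Ω = periodize (fun _ : Fin θ.D => P) (cubeFam true θ.L a M ρ k) → j.1.1.1.1.1.k = k →
        SockB9P3H2 (𝔸 := θ.𝔸) θ.L B₀ B₀β cP β len j.1.1.1.1.1.η j.1.1.1.1.1.k j.1.1.1.1.1.Ω j.1.1.1.1.1.Λs
          (fun m l => towerBondsP θ.L j.1.1.1.1.1.Ω (j.1.1.1.1.1.Λs m) l) := by
  obtain ⟨B₀, B₀β, cP, hB₀, hB₀β, hcP, H⟩ := sockB9P3H2_periodize_idxB8SubD θ hD M hρ hk hβ hlen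
  exact ⟨B₀, B₀β, cP, hB₀, hB₀β, hcP, fun a P hdvd hP j hΩ hkk => H a P hdvd hP j.1 hΩ hkk⟩

/-- ★ **NON-VACUITY: SUCH MEMBERS OF THE PERIODIC CUT EXIST, AND THE SOCKET HOLDS THERE** — at dag-n05-w2's carried member of `IdxB8SubDPer θ P` over the periodised
tower `periodize (fun _ ↦ P) (cubeFam true θ.L a M ρ k)` (spacing `η = L⁻ᵏ`, `exists_idxB8SubDPer_periodize_cubeFam`), for every period `P` with `θ.Lᵏ ∣ P` and
`θ.Lᵏ·M + 2·ρ·gs θ.L k ≤ P` (a NESTED periodic member when `d ≥ 1`: dag-n05-w2's `periodize_cubeFam_one_ne_univ`).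
[cite: Balaban1985RegularSpaces, (1.59) p.86, (1.131) p.99, (1.3)–(1.5) p.77, p.77 («Ω_j = T_η»); Balaban1984PropagatorsII, (2.1) p.224] -/
theorem exists_idxB8SubDPer_sockB9P3H2_periodize (θ : Stage3Params) [FiniteDimensional ℂ θ.𝔸] (hD : 2 ≤ θ.D) (M : ℕ) {ρ : ℕ}
    (hρ : θ.L ≤ ρ) {k : ℕ} (hk : 1 ≤ k) {β : ℝ} (hβ : 0 ≤ β) {len : Site θ.D → ℝ} (hlen : ∀ z : Site θ.D, z ≠ 0 → 1 ≤ len z) :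
    ∃ B₀ B₀β cP : ℝ, 0 < B₀ ∧ 0 < B₀β ∧ 0 < cP ∧ ∀ (a : Site θ.D) (P : ℕ), θ.L ^ k ∣ P → θ.L ^ k * M + 2 * (ρ * gs θ.L k) ≤ P →
      ∃ j : IdxB8SubDPer θ P, j.1.1.1.1.1.Ω = periodize (fun _ : Fin θ.D => P) (cubeFam true θ.L a M ρ k) ∧ j.1.1.1.1.1.k = k ∧
        SockB9P3H2 (𝔸 := θ.𝔸) θ.L B₀ B₀β cP β len j.1.1.1.1.1.η j.1.1.1.1.1.k j.1.1.1.1.1.Ω j.1.1.1.1.1.Λs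
          (fun m l => towerBondsP θ.L j.1.1.1.1.1.Ω (j.1.1.1.1.1.Λs m) l) := by
  have hL : 1 ≤ θ.L := le_trans (by norm_num) θ.two_le_L
  obtain ⟨B₀, B₀β, cP, hB₀, hB₀β, hcP, H⟩ := sockB9P3H2_periodize_idxB8SubDPer θ hD M hρ hk hβ hlen
  refine ⟨B₀, B₀β, cP, hB₀, hB₀β, hcP, fun a P hdvd hP => ?_⟩
  have hρ1 : 1 ≤ ρ := hL.trans hρ
  have hP0 : 0 < P := B8Ineq159PeriodizedTowerReads.period_pos (L := θ.L) (M := M) (k := k) hρ1 hP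
  obtain ⟨j, -, hkk, hΩ⟩ := exists_idxB8SubDPer_periodize_cubeFam θ a M hρ hk hP0 hdvd
  exact ⟨j, hΩ, hkk, H a P hdvd hP j hΩ hkk⟩

/-! ## §2 One triple of constants for all depths `k ≤ K` -/

/-- ★★ **ONE TRIPLE OF CONSTANTS FOR ALL DEPTHS `1 ≤ k ≤ K`** over periodised Sect.-F towers of shape `(M, ρ)` (finite maximum over the depths of a programme of bounded
depth; the constants DEPEND ON `K` — bookkeeping, NOT [4] Thm 3.3's depth-uniform `B₀(d, L)`). [cite: Balaban1985RegularSpaces, (1.59) p.86, (1.131) p.99, p.77 («Ω_j = T_η»); Balaban1985BackgroundPropagators, Thm 3.3 p.399] -/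
theorem sockB9P3H2_periodize_lawMember_depth (θ : Stage3Params) [FiniteDimensional ℂ θ.𝔸] (hD : 2 ≤ θ.D) (M : ℕ) {ρ : ℕ} (hρ : θ.L ≤ ρ)
    {β : ℝ} (hβ : 0 ≤ β) {len : Site θ.D → ℝ} (hlen : ∀ z : Site θ.D, z ≠ 0 → 1 ≤ len z) :
    ∀ K : ℕ, ∃ B₀ B₀β cP : ℝ, 0 < B₀ ∧ 0 < B₀β ∧ 0 < cP ∧ ∀ k, 1 ≤ k → k ≤ K →
      ∀ (a : Site θ.D) (P : ℕ), θ.L ^ k ∣ P → θ.L ^ k * M + 2 * (ρ * gs θ.L k) ≤ P →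
      ∀ i : ZdIdx θ.D θ.L, i.Ω = periodize (fun _ : Fin θ.D => P) (cubeFam true θ.L a M ρ k) → i.k = k →
      IdxB8Laws θ.L i → DomainSeq θ.L i.Ω → (∀ l, l < i.k → ∀ z ∈ i.Λs i.k l, ((θ.L : ℤ) ^ l) • z ∈ Lam θ.L i.Ω l) →
        SockB9P3H2 (𝔸 := θ.𝔸) θ.L B₀ B₀β cP β len i.η i.k i.Ω i.Λs (fun m j => towerBondsP θ.L i.Ω (i.Λs m) j)
  | 0 => ⟨1, 1, 1, one_pos, one_pos, one_pos, fun k h1 h0 => by omega⟩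
  | K + 1 => by
    obtain ⟨B₁, B₁β, c₁, hB₁, hB₁β, hc₁, H₁⟩ := sockB9P3H2_periodize_lawMember_depth θ hD M hρ hβ hlen K
    obtain ⟨B₂, B₂β, c₂, hB₂, hB₂β, hc₂, H₂⟩ := sockB9P3H2_periodize_lawMember θ hD M hρ (k := K + 1) (by omega) hβ hlen
    refine ⟨max B₁ B₂, max B₁β B₂β, min c₁ c₂, lt_max_of_lt_left hB₁, lt_max_of_lt_left hB₁β, lt_min hc₁ hc₂,
      fun k h1 hk a P hdvd hP i hΩ hkk hlaws hdom h15 => ?_⟩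
    rcases Nat.lt_or_ge k (K + 1) with hlt | hge
    · exact sockB9P3H2_mono i.hη.le (le_max_left _ _) (le_max_left _ _) (min_le_left _ _)
        (H₁ k h1 (by omega) a P hdvd hP i hΩ hkk hlaws hdom h15)
    · have hkK : k = K + 1 := le_antisymm hk hge
      subst hkK
      exact sockB9P3H2_mono i.hη.le (le_max_right _ _) (le_max_right _ _) (min_le_right _ _)
        (H₂ a P hdvd hP i hΩ hkk hlaws hdom h15)

end Literature.MathematicalPhysics.QuantumFieldTheory.Balaban1983to89.B8SockB9P3H2AtPeriodizedTowerMember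

end
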